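/-
Route `EguchiKawaiDirectionLadder` (ideator ym-idea-2, LINE 8) — the proved Eguchi–Kawai breakdown, transferred from the
gauge group `U(N)` to `SU(N)` (width seat w4 of LEAD ym-line-cbag-p1).
-/
import Summits.QuantumFields.YangMills.Theorems.EguchiKawaiDirectionLadderBreakdownHolds
import Summits.QuantumFields.YangMills.Theorems.EguchiKawaiDirectionLadderOrderParameterFloor
import Literature.Barriers.QuantumFields.EguchiKawaiBreakdownSpecialUnitary
import HarnessLib

/-!
# Route `EguchiKawaiDirectionLadder`: the Eguchi–Kawai breakdown for the gauge group `SU(N)`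

The barrier-ledger fact `Literature.Barriers.QuantumFields.EguchiKawaiBreakdown` is stated for the single-site model
with link variables in `U(N)` (centre `U(1)`); scope caveat (e) of the entry leaves the `SU(N)` model (centre `ℤ_N`,
Makeenko's footnote p. 246) outside the formal scope.  The cell proved the fact (`EguchiKawaiBreakdown_holds`, K_A
`tripleSmallBallMargin_proof` + K_B `directionIncrement_unconditional` + Assembly) and its quantitative every-direction
form (`ekOrderParameter_floor`, `eguchiKawaiBreakdown_allDirections`).  The Literature file
`EguchiKawaiBreakdownSpecialUnitary` proves that the `SU(N)` single-site model — same reduced action and weight,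
product Haar measure of `SU(N)` — has THE SAME open-line order parameter for every `d`, `N`, `b`, `μ`
(`ekOrderParameterSU_eq`: `U(N) = U(1)·SU(N)` linkwise and the observables are phase invariant).  Hence everything the
cell proved holds verbatim for `SU(N)`; this file records the unconditional statements:

* `eguchiKawaiBreakdown_specialUnitary` — for every `d ≥ 3` there is `b₀ ≥ 0` such that for all `b > b₀` the open-line
  order parameter `⟨|(1/N) tr V_μ|²⟩` of the `SU(N)` Eguchi–Kawai model does not tend to `0` in some direction;
* `eguchiKawaiBreakdown_specialUnitary_allDirections` — the same in EVERY direction;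
* `ekOrderParameterSU_floor` — the explicit floor `1/(40 d²)` eventually in `N`, every direction;
* `not_ekOpenLinesVanishSU` — the standing hypothesis of the naive reduction fails for the `SU(N)` model at weak coupling.

HONEST FRAMING.  This is the Eguchi–Kawai BREAKDOWN direction (negative knowledge about the naive, untwisted single-site
reduction at weak coupling, now for both `U(N)` and `SU(N)`); no summit statement, no Yang–Mills mass gap, no continuum
limit and no large-`N` reduction is proved or advanced here.
-/

set_option autoImplicit false

noncomputable section

open Filter Topology
open Literature.Barriers.QuantumFields

namespace Summit.QuantumFields.YangMills.Theorems.EguchiKawaiDirectionLadder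

/-- **The Eguchi–Kawai breakdown for `SU(N)` (unconditional).** For every `d ≥ 3` there is `b₀ ≥ 0` such that for all
inverse 't Hooft couplings `b > b₀` the open-line order parameter of the `SU(N)` single-site model does not tend to `0`
as `N → ∞` in some direction `μ`. -/
theorem eguchiKawaiBreakdown_specialUnitary (d : ℕ) (hd : 3 ≤ d) :
    ∃ b₀ : ℝ, 0 ≤ b₀ ∧ ∀ b : ℝ, b₀ < b →
      ∃ μ : Fin d, ¬ Tendsto (fun N : ℕ => ekOrderParameterSU d N b μ) atTop (𝓝 0) :=
  EguchiKawaiBreakdown_holds.specialUnitary hd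

/-- **The `SU(N)` breakdown in EVERY direction.** For every `d ≥ 3` there is `b₀ ≥ 0` such that for all `b > b₀` and
every direction `μ` the open-line order parameter of the `SU(N)` model does not tend to `0`. -/
theorem eguchiKawaiBreakdown_specialUnitary_allDirections (d : ℕ) (hd : 3 ≤ d) :
    ∃ b₀ : ℝ, 0 ≤ b₀ ∧ ∀ b : ℝ, b₀ < b → ∀ μ : Fin d,
      ¬ Tendsto (fun N : ℕ => ekOrderParameterSU d N b μ) atTop (𝓝 0) := by
  simp only [ekOrderParameterSU_eq]
  exact eguchiKawaiBreakdown_allDirections d hd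

/-- **The explicit floor for the `SU(N)` model.** For every `d ≥ 3` there is `b₀ ≥ 0` such that for every `b > b₀` and
every direction `μ`, for all large `N`, `⟨|(1/N) tr V_μ|²⟩_{SU(N)} ≥ 1/(40 d²)`. -/
theorem ekOrderParameterSU_floor (d : ℕ) (hd : 3 ≤ d) :
    ∃ b₀ : ℝ, 0 ≤ b₀ ∧ ∀ b : ℝ, b₀ < b → ∀ μ : Fin d,
      ∃ N₀ : ℕ, ∀ N : ℕ, N₀ ≤ N → 1 / (40 * (d : ℝ) ^ 2) ≤ ekOrderParameterSU d N b μ := by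
  simp only [ekOrderParameterSU_eq]
  exact ekOrderParameter_floor d hd

/-- **The naive reduction hypothesis fails for `SU(N)` at weak coupling.** For every `d ≥ 3` there is `b₀ ≥ 0` such that
for all `b > b₀`, `¬ EKOpenLinesVanishSU d b`. -/
theorem not_ekOpenLinesVanishSU (d : ℕ) (hd : 3 ≤ d) :
    ∃ b₀ : ℝ, 0 ≤ b₀ ∧ ∀ b : ℝ, b₀ < b → ¬ EKOpenLinesVanishSU d b :=
  EguchiKawaiBreakdown_holds.not_ekOpenLinesVanishSU hd

/-- In the summit's dimension `d = 4`: the `SU(N)` Eguchi–Kawai model breaks its centre symmetry at weak coupling, in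
every direction, with the floor `1/640`. -/
theorem ekOrderParameterSU_floor_four :
    ∃ b₀ : ℝ, 0 ≤ b₀ ∧ ∀ b : ℝ, b₀ < b → ∀ μ : Fin 4,
      ∃ N₀ : ℕ, ∀ N : ℕ, N₀ ≤ N → (1 : ℝ) / 640 ≤ ekOrderParameterSU 4 N b μ := by
  obtain ⟨b₀, hb₀, h⟩ := ekOrderParameterSU_floor 4 (by norm_num)
  refine ⟨b₀, hb₀, fun b hb μ => ?_⟩
  obtain ⟨N₀, hN⟩ := h b hb μ
  refine ⟨N₀, fun N hNN => ?_⟩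
  have := hN N hNN
  norm_num at this
  exact this

end Summit.QuantumFields.YangMills.Theorems.EguchiKawaiDirectionLadder

end
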